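import Literature.MathematicalPhysics.QuantumFieldTheory.Balaban1983to89.B3Op116RegionSources
import Literature.MathematicalPhysics.QuantumFieldTheory.Balaban1983to89.B1Cor23RegularRegion

/-!
# Bałaban, *(Higgs)₂,₃ quantum fields in a finite volume III. Renormalization* [B3] — the operator (1.16) p. 414 for a perturbation
`P` of the background: THE SOURCES OF `V_k(P,Y)` LIVE ON `supp P` (bond sources) and on the `k`-blocks met by `supp P` (averaging
sources); `G_k(Ω,X)` is block-diagonal for `T_ε = Ω ⊔ Ωᶜ` on a `k`-block union; the per-bond-charge rows of `T(V_k(P,Y)w)` restricted to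
the support — file «CollarSources» of the cell's Route δ for the class-(c) sentence of p. 433 (twin of `B3Op116RegionSources`, re-keyed
from p. 412's deep support to an ARBITRARY support)

statement-level skeleton of published theorems with citation tags; proofs where landed; nothing here is a claim about the Yang–Mills mass gap

T. Bałaban, Commun. Math. Phys. **88** (1983) 411–445 [cite: Balaban1983Higgs3]; part I, Commun. Math. Phys. **85** (1982) 603–636
[cite: Balaban1982Higgs1].  PDFs held: `paper:balaban1983-higgs-2-3-quantum-fields-finite-volume` (journal page = PDF page + 410;
p. 414 = `p0004.txt`, p. 433 = `p0023.txt`), `paper:balaban1982-cmp85-higgs23-i` (p. 615 = `p0013.txt`).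

CITATION HEADER (lean-in-tree rule).  Cell `lit-balaban` (HOME `run/shared/lean/pub/lit-balaban/`), Phase-2 proof seat **p40** gen 77
(unit `lit-balaban-p40`, literature-prover-lit-balaban-p40-g77-0); free-target protocol G.5-34(d), TAKING line HOME/STATUS.md
2026-08-23T12:41:06Z (cc r15 = fold owner of rows B3.Txt@433 / B3.Prop1 / B3.Eq1.16 / B3.Eq2.5, p35, r14, p33); design note
`lit-balaban-p40/DESIGN-B3-116-box.md` v3 §5/§5.1 (Route δ, recorded by the owner as the cell's candidate proof-route deviation for class (c),
HOME/GAPS.md «G-B3-16 ADDENDUM 1», owner note l.2887).  LOCATED SUPPORT FILE — no head claim.  Sibling of the engine `B3Op116CollarRows`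
(p40 g77).  USED BY NAME, never restated: p40 g75's `B3Op116RegionSources.{mulM_eq_zero, srcMD_eq_zero, srcDM_eq_zero, srcMM_eq_zero,
bondSrc_eq_zero, multiContourSum_eq_zero, cutV}`, r14's `B3Op116SourceForm.{srcV, srcMD, srcDM, srcMM, bondSrc, avgSrc, map_srcV,
norm_mapE_srcMD_le, norm_mapE_srcMM_le, norm_mapE_srcDM_le, norm_mapE_le_sum_norm_mul_col, norm_propagatorK_srcDM_apply_le}`, r14 g14's
block-diagonality `B1Cor23RegularRegion.{propagatorK_indicator_comm, propagatorK_supported}`, p40's `B3Op116Pieces.{fTwo, fTwoAdj,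
norm_fTwo_apply_le, norm_fTwoAdj_apply_le, fOne, norm_fOne_apply_le, norm_U_apply}`, (v1.1) p35's `B3Op116LeibnizRows.{pred, nMul,
map_srcV_univ_leibniz, norm_nMul_apply_le, U_neg_mulM_apply}` and R1's `nMul_eq_zero`, the typer's
`HiggsLattice`/`HiggsCovariance`/`HiggsCovariancePos.Inside`/`HiggsAveraging`.

## What is printed

[B3] p. 414 [PDF 4] (verbatim): *"if we expand the propagator G_k(Ω, A + B) using the formulas (I.3.44), (I.3.45), then in the last term
of this expansion, equal to [G_k(Ω, B)V_k(A, B)]^n G_k(Ω, A + B) [V_k(A, B)G_k(Ω, B)]^{n′}, (1.16) we have the propagator G_k(Ω, A + B)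
… Perhaps the simplest way is to treat it as an external field"*.  [B1] p. 615 (3.16) [PDF 13]: the operator `V_k(A,B)` as the sum of the
`F_{1,k}`-terms *"of the bonds ⊂ Ω"* and the averaging terms `a_kF_{2,k}(A,B)^*Q_k(B) + a_kQ_k^*(B)F_{2,k}(A,B) + a_kF_{2,k}(A,B)^*F_{2,k}(A,B)`
(r14's THEOREM A `B3Op116SourceForm.opV_apply_eq_srcV`).  [B3] p. 433 [PDF 23] (verbatim, class (c)): *"We have B̃ = B̃₀ + B̃′, and we
expand in B̃′ … (I.3.14), (I.3.44), and (I.3.45) … we include the operators (1.16) … into the external fields"* on the cube `□` — the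
cell's recorded route applies (I.3.44) ONCE to the collar part `P = B̃′(1 − χ)` of the perturbation (supported far from the localizations,
anywhere in `□` up to its faces, NOT in p. 412's deep regime), so the rows of `G_k(□,Y)V_k(P,Y)G_k(□,Y+P)` are finite sums over
`supp P`; this file isolates that support bookkeeping.  [B1] p. 610 (2.20): `G_k(Ω,A)` acts on *"functions φ : Ω → R^N"* — on the typer's
whole-torus carrier the operator is block-diagonal for `Ω ⊔ Ωᶜ` when `Ω` is a union of `k`-blocks (r14 g14).

## What this file proves

§1 VANISHING OFF THE SUPPORT (any `Ω`, `A`, `B`, `k ≤ K`): the three bond sources of a bond with `A_b = 0` vanish (R1, by name); the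
averaging sources `avgSrc w` vanish at every site `x` whose `k`-block carries no bond of `supp A` (`avgSrc_apply_eq_zero_of_forall`;
`NearSupp k A x` := some bond from the block of `x` carries `A`); the averaging sources through a vector-valued linear functional `T` are
bounded by block averages over the NEAR blocks only (`norm_mapE_avgSrc_near_le`).
§2 BLOCK-DIAGONALITY AS KERNEL VANISHING (`Ω` a union of `k`-blocks, `m² > 0`, `a_k ≥ 0`): `(G_k(Ω,X)δ_yv)(x) = 0` when exactly one of `x, y`
lies in `Ω` (`propagatorK_single_apply_eq_zero_of_not_mem` / `_of_mem`), the basis-column forms, and the vanishing of `D^ε_X` at a bond both of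
whose ends see a vanishing field (`covDeriv_eq_zero_of_apply_eq_zero`).
§3 THE PER-BOND-CHARGE ROWS ON THE SUPPORT (any `Ω`; `sup|A| ≤ s`): `collB Ω A` := the bonds `⊂ Ω` carrying `A`;
`‖T(V_k^Ω(A,B)w)‖ ≤ Σ_{b∈collB}[|e|s‖D^ε_Bw(b)‖κ_T(b₊) + ε⁻¹|e|s‖w(b₊)‖Σ_i‖T(dip_be_i)‖ + (|e|s)²‖w(b₊)‖κ_T(b₊)] + |a_k|(L^kε)^{−2}‖T(avgSrc w)‖`
(`norm_mapE_srcV_collar_le`); the propagator row with the dipole in the symmetric form and NO `ε⁻¹` (`norm_propagatorK_srcV_apply_collar_le`),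
and the derivative row of `T₀V_k` (`norm_covDeriv_map_srcV_collar_le`, the dipole entry = the twice-differentiated kernel).
§4 (v1.1) THE LOCATED LEIBNIZ ROW (any `Ω`; `sup|A| ≤ s`, `A` regular with `δ_A`; `T` killing every single-site field off `Ω`, `w`
vanishing off `Ω` — the rows/columns of `G_k(Ω,·)` at points of `Ω`, §2): `V_k^Ω w = V_k^{T_ε}w + Σ_{b⊄Ω} bondSrc_b w` (`srcV_eq_univ_add`),
p35's THEOREM A′ on the torus part, and the location of every bond (inside / leaving / entering / outside `Ω`; charged / uncharged):
`‖T(V_k^Ω w)‖ ≤ Σ_{b∈inB}[|e|s‖D^ε_Bw(b)‖κ_T(b₊) + (ε^{−1}|e|δ_A‖w(b₋)‖ + |e|s‖D^ε_Bw(b)‖)κ_T(b₋) + (|e|s)²‖w(b₊)‖κ_T(b₊)]`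
`+ Σ_{b∈exB}(ε^{−1}|e|δ_A + ε^{−1}|e|s)‖w(b₋)‖κ_T(b₋) + Σ_{b∈enB}(3ε^{−1}|e|s + 2(|e|s)²)‖w(b₊)‖κ_T(b₊) + |a_k|(L^kε)^{−2}‖T(avgSrc w)‖`
(`norm_mapE_srcV_collar_leibniz_le`; `inB`/`exB`/`enB` = the charged bonds inside / leaving, the bonds of `supp A` entering `Ω`) — no
twice-differentiated kernel; the bonds of `supp A` crossing `∂Ω` leave FACE CHARGES (value states with one `ε^{−1}`) at their endpoint in `Ω`,
to be summed over the `(d−1)`-dimensional faces (p40's `B3Op116CollarRows.sum_face_far_pair_le`); needed only by the Hölder-transported row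
of the collar operator (DESIGN-B3-116-box §1c/§5.1).

## Honest scope

Exact identities and triangle-inequality bounds only (no decay, no scale sums, no smallness); `Ω` any finite set of sites (a union of
`k`-blocks in §2), arbitrary `A, B, X, m² > 0, a, k ≤ K`, `N, d, L`; `s`, `δ_A` free parameters.  The class-(c) use on the cube `□` is a
RECORDED ROUTE DEVIATION from p. 433 l.12–15 (print's one-piece expansion on `□` is the cell's located open gap G-B3-16.A1); nothing of
(1.16)/(2.5) is asserted here.  Concrete `def`s (`NearSupp`, `collB`, `inB`, `exB`, `enB`); no `def … : Prop` fact, no new named fact, no `sorry`; axioms standard.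
-/

noncomputable section

open scoped BigOperators InnerProductSpace

namespace Literature.MathematicalPhysics.QuantumFieldTheory.Balaban1983to89.B3Op116CollarSources

open HiggsLattice (ChargeData ScalarField covDeriv)
open HiggsCovariance (propagatorK avgQkLin avgQkAdj E)
open HiggsCovariancePos (Inside)
open HiggsAveraging (blockK blockIter mem_blockK multiContourSum)
open B1Eq230FluctCov (Ix cb)
open B3Ineq210MixedRegularTorus (onb dip cb_eq_single)
open B3Op116Pieces (mulM fTwo fTwoAdj fTwo_apply fTwoAdj_apply norm_fTwo_apply_le norm_fTwoAdj_apply_le)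
open B3Op116SourceForm (mulMT srcV srcMD srcDM srcMM bondSrc avgSrc map_srcV norm_mapE_single_le norm_mapE_srcMD_le norm_mapE_srcMM_le
  norm_mapE_srcDM_le norm_mapE_le_sum_norm_mul_col norm_propagatorK_srcDM_apply_le covDerivAt)
open B3Op116RegionSources (mulM_eq_zero srcMD_eq_zero srcDM_eq_zero srcMM_eq_zero bondSrc_eq_zero multiContourSum_eq_zero)
open B3Op116KernelRegularTorus (norm_avgQkLin_apply_le_block)
open B1Cor23RegularRegion (propagatorK_indicator_comm propagatorK_supported)

variable {P : HiggsLattice.Params} {N : ℕ}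

/-! ## §1 The sources of `V_k(A,B)` vanish off `supp A` -/

section Vanish

variable (C : ChargeData N) (A B : HiggsLattice.VecField P 0) {k : ℕ}

/-- **Near the support**: the `k`-block of the site `x` is the base block of some bond carrying `A` — the only blocks on which the averaging
sources `F_{2,k}(A,B)`, `F_{2,k}(A,B)^*` of (I.3.16) can be nonzero. [cite: Balaban1982Higgs1, (3.15)–(3.16) pp.614–615] [cite: Balaban1983Higgs3, p.433] -/
def NearSupp (k : ℕ) (A : HiggsLattice.VecField P 0) (x : HiggsLattice.Site P 0) : Prop :=
  ∃ b : HiggsLattice.PBond P 0, A b ≠ 0 ∧ blockIter k b.src = blockIter k x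

variable {A}

/-- Off the near set every bond from the block of `x` carries no `A`. [cite: Balaban1983Higgs3, p.433] -/
theorem forall_eq_zero_of_not_nearSupp {x : HiggsLattice.Site P 0} (hx : ¬ NearSupp k A x) :
    ∀ b : HiggsLattice.PBond P 0, blockIter k b.src = blockIter k x → A b = 0 := by
  intro b hb
  by_contra h
  exact hx ⟨b, h, hb⟩

/-- `NearSupp` is a property of the `k`-block. [cite: Balaban1983Higgs3, p.433] -/
theorem NearSupp.of_blockIter_eq {x z : HiggsLattice.Site P 0} (h : NearSupp k A x) (hz : blockIter k z = blockIter k x) :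
    NearSupp k A z := by
  obtain ⟨b, hb, hbx⟩ := h
  exact ⟨b, hb, hbx.trans hz.symm⟩

variable (A)

/-- **`(F_{2,k}(A,B)w)(x̄) = 0` on a block carrying no bond of `supp A`** (`k ≤ K`; the staircase contours of the block holonomies stay in
the block, R1's `multiContourSum_eq_zero`). [cite: Balaban1982Higgs1, (3.15) p.614] [cite: Balaban1983Higgs3, p.433] -/
theorem fTwo_apply_eq_zero_of_forall (hk : k ≤ P.K) {x : HiggsLattice.Site P 0}
    (hx : ∀ b : HiggsLattice.PBond P 0, blockIter k b.src = blockIter k x → A b = 0) (w : ScalarField P 0 N) :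
    fTwo C A B k w (blockIter k x) = 0 := by
  rw [fTwo_apply]
  refine smul_eq_zero_of_right _ (Finset.sum_eq_zero fun z hz => ?_)
  have hzx : blockIter k z = blockIter k x := (mem_blockK k _ z).1 hz
  have hz' : ∀ b : HiggsLattice.PBond P 0, blockIter k b.src = blockIter k z → A b = 0 :=
    fun b hb => hx b (hb.trans hzx)
  rw [multiContourSum_eq_zero A hk hz', ChargeData.U_zero, one_apply_eq_self, sub_self]

/-- **`(F_{2,k}(A,B)^*ψ)(x) = 0` at a site whose block carries no bond of `supp A`** (`k ≤ K`). [cite: Balaban1982Higgs1, (3.16) p.615] [cite: Balaban1983Higgs3, p.433] -/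
theorem fTwoAdj_apply_eq_zero_of_forall (hk : k ≤ P.K) {x : HiggsLattice.Site P 0}
    (hx : ∀ b : HiggsLattice.PBond P 0, blockIter k b.src = blockIter k x → A b = 0) (ψ : ScalarField P k N) :
    fTwoAdj C A B k ψ x = 0 := by
  rw [fTwoAdj_apply, multiContourSum_eq_zero A hk hx, neg_zero, ChargeData.U_zero, one_apply_eq_self, sub_self, map_zero]

/-- **The averaging sources vanish at every site whose block carries no bond of `supp A`** (`k ≤ K`). [cite: Balaban1982Higgs1, (3.16) p.615] [cite: Balaban1983Higgs3, p.433] -/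
theorem avgSrc_apply_eq_zero_of_forall (hk : k ≤ P.K) {x : HiggsLattice.Site P 0}
    (hx : ∀ b : HiggsLattice.PBond P 0, blockIter k b.src = blockIter k x → A b = 0) (w : ScalarField P 0 N) :
    avgSrc C A B k w x = 0 := by
  rw [avgSrc, Pi.add_apply, Pi.add_apply, fTwoAdj_apply_eq_zero_of_forall C A B hk hx, fTwoAdj_apply_eq_zero_of_forall C A B hk hx,
    zero_add, add_zero]
  have h : ‖avgQkAdj C B k (fTwo C A B k w) x‖ = 0 := by
    rw [B3Ineq210RegularTorus.norm_avgQkAdj_apply', fTwo_apply_eq_zero_of_forall C A B hk hx, norm_zero]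
  exact norm_eq_zero.1 h

/-- The averaging sources vanish off the near set (`k ≤ K`). [cite: Balaban1982Higgs1, (3.16) p.615] [cite: Balaban1983Higgs3, p.433] -/
theorem avgSrc_apply_eq_zero_of_not_nearSupp (hk : k ≤ P.K) {x : HiggsLattice.Site P 0} (hx : ¬ NearSupp k A x)
    (w : ScalarField P 0 N) : avgSrc C A B k w x = 0 :=
  avgSrc_apply_eq_zero_of_forall C A B hk (forall_eq_zero_of_not_nearSupp hx) w

variable {M' : Type*} [NormedAddCommGroup M'] [NormedSpace ℝ M']

/-- the averaging size `m = |e|sεd(L^k − 1)` of p40's `norm_fTwo_apply_le` is nonnegative. [cite: Balaban1982Higgs1, (3.15) p.614] -/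
theorem avgM_nonneg (k : ℕ) {s : ℝ} (hs : 0 ≤ s) : 0 ≤ |C.e| * s * P.mesh 0 * (P.d * ((P.L : ℝ) ^ k - 1)) := by
  have hL1 : (1 : ℝ) ≤ (P.L : ℝ) ^ k := one_le_pow₀ (by exact_mod_cast P.hL)
  have : (0 : ℝ) ≤ (P.L : ℝ) ^ k - 1 := by linarith
  have := P.mesh_pos 0
  positivity

open scoped Classical in
/-- **THE AVERAGING SOURCES THROUGH `T`, BY BLOCK AVERAGES OVER THE NEAR BLOCKS ONLY** (`k ≤ K`, `sup_b|A_b| ≤ s`):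
`‖T(avgSrc w)‖ ≤ Σ_{y : NearSupp y} m(2+m)·(L^{−kd}Σ_{x∈B^k(ȳ)}‖w(x)‖)·κ_T(y)`, `m = |e|sεd(L^k−1)`, `κ_T(y) = Σ_i‖Te_{(y,i)}‖` (R1's
`norm_mapE_avgSrc_region_le` with the deep blocks replaced by the near blocks, no truncation of the values).
[cite: Balaban1982Higgs1, (3.15)–(3.16) pp.614–615] [cite: Balaban1983Higgs3, (1.16) p.414, p.433] -/
theorem norm_mapE_avgSrc_near_le (T : ScalarField P 0 N →ₗ[ℝ] M') (hk : k ≤ P.K) {s : ℝ} (hs : 0 ≤ s)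
    (hA : ∀ b : HiggsLattice.PBond P 0, |A b| ≤ s) (w : ScalarField P 0 N) :
    ‖T (avgSrc C A B k w)‖
      ≤ ∑ y ∈ Finset.univ.filter (fun y : HiggsLattice.Site P 0 => NearSupp k A y),
          ((|C.e| * s * P.mesh 0 * (P.d * ((P.L : ℝ) ^ k - 1))) * (2 + |C.e| * s * P.mesh 0 * (P.d * ((P.L : ℝ) ^ k - 1))) *
            (((P.L : ℝ) ^ (k * P.d))⁻¹ * ∑ x ∈ blockK k (blockIter k y), ‖w x‖)) *
          ∑ i : Ix N, ‖T (cb P N 0 (y, i))‖ := by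
  set m : ℝ := |C.e| * s * P.mesh 0 * (P.d * ((P.L : ℝ) ^ k - 1)) with hm
  have hm0 : 0 ≤ m := avgM_nonneg C k hs
  rw [Finset.sum_filter]
  refine (norm_mapE_le_sum_norm_mul_col T _).trans (Finset.sum_le_sum fun y _ => ?_)
  by_cases hy : NearSupp k A y
  · rw [if_pos hy]
    refine mul_le_mul_of_nonneg_right ?_ (Finset.sum_nonneg fun _ _ => norm_nonneg _)
    set avg : ℝ := ((P.L : ℝ) ^ (k * P.d))⁻¹ * ∑ x ∈ blockK k (blockIter k y), ‖w x‖ with havg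
    have hQ : ‖avgQkLin C B k w (blockIter k y)‖ ≤ avg := norm_avgQkLin_apply_le_block C k B w _
    have hF : ‖fTwo C A B k w (blockIter k y)‖ ≤ m * avg := norm_fTwo_apply_le C A B k hk hs hA w _
    rw [avgSrc, Pi.add_apply, Pi.add_apply]
    have e1 : ‖fTwoAdj C A B k (avgQkLin C B k w) y‖ ≤ m * avg :=
      (norm_fTwoAdj_apply_le C A B k hk hs hA _ y).trans (mul_le_mul_of_nonneg_left hQ hm0)
    have e2 : ‖avgQkAdj C B k (fTwo C A B k w) y‖ ≤ m * avg := by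
      rw [B3Ineq210RegularTorus.norm_avgQkAdj_apply']; exact hF
    have e3 : ‖fTwoAdj C A B k (fTwo C A B k w) y‖ ≤ m * (m * avg) :=
      (norm_fTwoAdj_apply_le C A B k hk hs hA _ y).trans (mul_le_mul_of_nonneg_left hF hm0)
    calc ‖fTwoAdj C A B k (avgQkLin C B k w) y + avgQkAdj C B k (fTwo C A B k w) y + fTwoAdj C A B k (fTwo C A B k w) y‖
        ≤ ‖fTwoAdj C A B k (avgQkLin C B k w) y + avgQkAdj C B k (fTwo C A B k w) y‖ + ‖fTwoAdj C A B k (fTwo C A B k w) y‖ :=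
          norm_add_le _ _
      _ ≤ (m * avg + m * avg) + m * (m * avg) := add_le_add ((norm_add_le _ _).trans (add_le_add e1 e2)) e3
      _ = m * (2 + m) * avg := by ring
  · rw [if_neg hy, avgSrc_apply_eq_zero_of_not_nearSupp C A B hk hy, norm_zero, zero_mul]

end Vanish

/-! ## §2 Block-diagonality of `G_k(Ω,X)` on a `k`-block union, as the vanishing of kernel entries -/

section BlockDiag

variable (C : ChargeData N) (Ω : Finset (HiggsLattice.Site P 0)) (X : HiggsLattice.VecField P 0) {msq : ℝ} (a : ℝ) {k : ℕ}
  (hmsq : 0 < msq) (hak : 0 ≤ B1.aSeq a P.L k)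
  (hΩ : ∀ x x' : HiggsLattice.Site P 0, blockIter k x = blockIter k x' → (x ∈ Ω ↔ x' ∈ Ω))
include hmsq hak hΩ

/-- **`G_k(Ω,X)` of a field supported OFF `Ω` vanishes ON `Ω`** (`Ω` a union of `k`-blocks, `m² > 0`, `a_k ≥ 0`; r14's
`propagatorK_indicator_comm` with `1_Ωg = 0`). [cite: Balaban1982Higgs1, (2.20) p.610] -/
theorem propagatorK_apply_eq_zero_of_supported_off (g : ScalarField P 0 N) (hg : ∀ y ∈ Ω, g y = 0)
    {x : HiggsLattice.Site P 0} (hx : x ∈ Ω) : propagatorK C Ω X msq a k g x = 0 := by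
  have h := propagatorK_indicator_comm C Ω X hmsq hak hΩ g
  have hg0 : (fun y => if y ∈ Ω then g y else 0) = (0 : ScalarField P 0 N) := by
    funext y
    split_ifs with hy
    · exact hg y hy
    · rfl
  rw [hg0, map_zero] at h
  have hx' := congrFun h x
  rw [Pi.zero_apply, if_pos hx] at hx'
  exact hx'.symm

/-- **`(G_k(Ω,X)δ_yv)(x) = 0` for `y ∉ Ω`, `x ∈ Ω`.** [cite: Balaban1982Higgs1, (2.20) p.610] -/
theorem propagatorK_single_apply_eq_zero_of_not_mem {y x : HiggsLattice.Site P 0} (hy : y ∉ Ω) (hx : x ∈ Ω) (v : E N) :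
    propagatorK C Ω X msq a k (Pi.single y v) x = 0 :=
  propagatorK_apply_eq_zero_of_supported_off C Ω X a hmsq hak hΩ _
    (fun z hz => Pi.single_eq_of_ne (fun h : z = y => hy (h ▸ hz)) _) hx

/-- **`(G_k(Ω,X)δ_yv)(x) = 0` for `y ∈ Ω`, `x ∉ Ω`** (r14's `propagatorK_supported`). [cite: Balaban1982Higgs1, (2.20) p.610] -/
theorem propagatorK_single_apply_eq_zero_of_mem {y x : HiggsLattice.Site P 0} (hy : y ∈ Ω) (hx : x ∉ Ω) (v : E N) :
    propagatorK C Ω X msq a k (Pi.single y v) x = 0 :=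
  propagatorK_supported C Ω X hmsq hak hΩ _ (fun z hz => Pi.single_eq_of_ne (fun h : z = y => hz (h ▸ hy)) _) x hx

/-- The basis column of a source off `Ω` vanishes on `Ω`. [cite: Balaban1982Higgs1, (2.20) p.610] -/
theorem propagatorK_cb_apply_eq_zero_of_not_mem {y x : HiggsLattice.Site P 0} (hy : y ∉ Ω) (hx : x ∈ Ω) (i : Ix N) :
    propagatorK C Ω X msq a k (cb P N 0 (y, i)) x = 0 := by
  rw [cb_eq_single]; exact propagatorK_single_apply_eq_zero_of_not_mem C Ω X a hmsq hak hΩ hy hx _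

/-- The basis column of a source in `Ω` vanishes off `Ω`. [cite: Balaban1982Higgs1, (2.20) p.610] -/
theorem propagatorK_cb_apply_eq_zero_of_mem {y x : HiggsLattice.Site P 0} (hy : y ∈ Ω) (hx : x ∉ Ω) (i : Ix N) :
    propagatorK C Ω X msq a k (cb P N 0 (y, i)) x = 0 := by
  rw [cb_eq_single]; exact propagatorK_single_apply_eq_zero_of_mem C Ω X a hmsq hak hΩ hy hx _

/-- The dipole of a bond OFF `Ω` (both ends `∉ Ω`) through `G_k(Ω,X)` vanishes on `Ω`. [cite: Balaban1982Higgs1, (1.7) p.605, (2.20) p.610] -/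
theorem propagatorK_dip_apply_eq_zero_of_not_mem (X' : HiggsLattice.VecField P 0) {b : HiggsLattice.PBond P 0} (h₁ : b.src ∉ Ω)
    (h₂ : b.tgt ∉ Ω) {x : HiggsLattice.Site P 0} (hx : x ∈ Ω) (Y : E N) :
    propagatorK C Ω X msq a k (dip C X' b Y) x = 0 := by
  rw [dip, map_sub, Pi.sub_apply, propagatorK_single_apply_eq_zero_of_not_mem C Ω X a hmsq hak hΩ h₂ hx,
    propagatorK_single_apply_eq_zero_of_not_mem C Ω X a hmsq hak hΩ h₁ hx, sub_zero]

omit hmsq hak hΩ in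
/-- `(D^ε_Xφ)(b) = 0` when `φ` vanishes at both ends of `b`. [cite: Balaban1982Higgs1, (1.7) p.605] -/
theorem covDeriv_eq_zero_of_apply_eq_zero (φ : ScalarField P 0 N) {b : HiggsLattice.PBond P 0} (h₁ : φ b.src = 0) (h₂ : φ b.tgt = 0) :
    covDeriv C X φ b = 0 := by
  rw [covDeriv, h₁, h₂, map_zero, sub_zero, smul_zero]

/-- The covariant derivative at a bond INSIDE `Ω` of the basis column of a source off `Ω` vanishes. [cite: Balaban1982Higgs1, (1.7) p.605, (2.20) p.610] -/
theorem covDeriv_propagatorK_cb_eq_zero_of_not_mem (X' : HiggsLattice.VecField P 0) {y : HiggsLattice.Site P 0} (hy : y ∉ Ω)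
    {b : HiggsLattice.PBond P 0} (hb : Inside Ω b) (i : Ix N) :
    covDeriv C X' (propagatorK C Ω X msq a k (cb P N 0 (y, i))) b = 0 :=
  covDeriv_eq_zero_of_apply_eq_zero C X' _ (propagatorK_cb_apply_eq_zero_of_not_mem C Ω X a hmsq hak hΩ hy hb.1 i)
    (propagatorK_cb_apply_eq_zero_of_not_mem C Ω X a hmsq hak hΩ hy hb.2 i)

end BlockDiag

/-! ## §3 The per-bond-charge rows of `V_k^Ω(A,B)` on the support -/

section CollarRows

open scoped Classical

variable (C : ChargeData N) (Ω : Finset (HiggsLattice.Site P 0)) (A B : HiggsLattice.VecField P 0) (a : ℝ) (k : ℕ)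

/-- **The collar bonds**: the bonds `⊂ Ω` carrying `A` — the only bonds whose (I.3.16)-sources of `V_k^Ω(A,B)` are nonzero.
[cite: Balaban1982Higgs1, (3.16) p.615] [cite: Balaban1983Higgs3, (1.16) p.414, p.433] -/
def collB (Ω : Finset (HiggsLattice.Site P 0)) (A : HiggsLattice.VecField P 0) : Finset (HiggsLattice.PBond P 0) :=
  Finset.univ.filter fun b => Inside Ω b ∧ A b ≠ 0

variable {Ω A}

/-- Membership in the collar bond set. [cite: Balaban1983Higgs3, p.433] -/
theorem mem_collB {b : HiggsLattice.PBond P 0} : b ∈ collB Ω A ↔ Inside Ω b ∧ A b ≠ 0 := by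
  simp [collB]

/-- A sum over the bonds `⊂ Ω` of terms vanishing where `A_b = 0` is a sum over the collar bonds. [cite: Balaban1983Higgs3, p.433] -/
theorem sum_ite_inside_eq_sum_collB {M : Type*} [AddCommMonoid M] (f : HiggsLattice.PBond P 0 → M)
    (hf : ∀ b, A b = 0 → f b = 0) :
    (∑ b : HiggsLattice.PBond P 0, if Inside Ω b then f b else 0) = ∑ b ∈ collB Ω A, f b := by
  rw [collB, Finset.sum_filter]
  refine Finset.sum_congr rfl fun b _ => ?_
  by_cases h1 : Inside Ω b
  · by_cases h2 : A b = 0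
    · rw [if_pos h1, hf b h2, if_neg (fun h => h.2 h2)]
    · rw [if_pos h1, if_pos ⟨h1, h2⟩]
  · rw [if_neg h1, if_neg (fun h => h1 h.1)]

variable (Ω A)
variable {M' : Type*} [NormedAddCommGroup M'] [NormedSpace ℝ M']

/-- **Separation of the sources of `V_k^Ω(A,B)w` through a linear `T`, ON THE SUPPORT**:
`T(V_kw) = −Σ_{b∈collB}[T srcMD_b w + ε⁻¹T srcDM_b w + T srcMM_b w] − a_k(L^kε)^{−2}T(avgSrc w)` (r14's `map_srcV`; the three sources of a bond
with `A_b = 0` vanish, R1). [cite: Balaban1982Higgs1, (3.16) p.615] [cite: Balaban1983Higgs3, (1.16) p.414, p.433] -/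
theorem map_srcV_collar {M'' : Type*} [AddCommGroup M''] [Module ℝ M''] (T : ScalarField P 0 N →ₗ[ℝ] M'') (w : ScalarField P 0 N) :
    T (srcV C A B k Ω a w)
      = -(∑ b ∈ collB Ω A, (T (srcMD C A B b w) + (P.mesh 0)⁻¹ • T (srcDM C A B b w) + T (srcMM C A B b w)))
        - (B1.aSeq a P.L k * ((P.mesh k)⁻¹ ^ 2)) • T (avgSrc C A B k w) := by
  rw [map_srcV, sum_ite_inside_eq_sum_collB]
  intro b hb
  rw [srcMD_eq_zero C A B hb, srcDM_eq_zero C A B hb, srcMM_eq_zero C A B hb, map_zero, smul_zero, add_zero, add_zero]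

/-- **`V_k^Ω(A,B)w` THROUGH A VECTOR-VALUED LINEAR FUNCTIONAL `T`, SUMMED OVER THE COLLAR BONDS ONLY** (`sup_b|A_b| ≤ s`):
`‖T(V_kw)‖ ≤ Σ_{b∈collB}[|e|s‖D^ε_Bw(b)‖κ_T(b₊) + ε^{−1}|e|s‖w(b₊)‖Σ_i‖T(dip_be_i)‖ + (|e|s)²‖w(b₊)‖κ_T(b₊)] + |a_k|(L^kε)^{−2}‖T(avgSrc w)‖`,
`κ_T(y) = Σ_i‖Te_{(y,i)}‖` (r14's `norm_mapE_srcV_le` restricted to `supp A`). [cite: Balaban1982Higgs1, (3.16) p.615] [cite: Balaban1983Higgs3, (1.16) p.414, p.433] -/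
theorem norm_mapE_srcV_collar_le (T : ScalarField P 0 N →ₗ[ℝ] M') {s : ℝ} (hA : ∀ b : HiggsLattice.PBond P 0, |A b| ≤ s)
    (w : ScalarField P 0 N) :
    ‖T (srcV C A B k Ω a w)‖
      ≤ (∑ b ∈ collB Ω A,
          (|C.e| * s * ‖covDeriv C B w b‖ * (∑ i : Ix N, ‖T (cb P N 0 (b.tgt, i))‖)
            + (P.mesh 0)⁻¹ * (|C.e| * s * ‖w b.tgt‖ * ∑ i : Ix N, ‖T (dip C B b (onb N i))‖)
            + (|C.e| * s) ^ 2 * ‖w b.tgt‖ * (∑ i : Ix N, ‖T (cb P N 0 (b.tgt, i))‖)))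
        + |B1.aSeq a P.L k| * (P.mesh k)⁻¹ ^ 2 * ‖T (avgSrc C A B k w)‖ := by
  rw [map_srcV_collar]
  refine (norm_sub_le _ _).trans (add_le_add ?_ ?_)
  · rw [norm_neg]
    refine (norm_sum_le _ _).trans (Finset.sum_le_sum fun b _ => ?_)
    refine (norm_add_le _ _).trans (add_le_add ((norm_add_le _ _).trans (add_le_add ?_ ?_)) ?_)
    · exact norm_mapE_srcMD_le C A B T (hA b) w
    · rw [norm_smul, Real.norm_eq_abs, abs_of_pos (inv_pos.mpr (P.mesh_pos 0))]
      exact mul_le_mul_of_nonneg_left (norm_mapE_srcDM_le C A B T (hA b) w) (inv_nonneg.mpr (P.mesh_pos 0).le)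
    · exact norm_mapE_srcMM_le C A B T (hA b) w
  · rw [norm_smul, Real.norm_eq_abs, abs_mul, abs_of_nonneg (pow_nonneg (inv_nonneg.mpr (P.mesh_pos k).le) 2)]

variable (X : HiggsLattice.VecField P 0) (msq : ℝ)

/-- **ROW OF A PROPAGATOR ON `V_k^Ω(A,B)`, OVER THE COLLAR BONDS, NO `ε^{−1}` LEFT** (`sup_b|A_b| ≤ s`; every region `Ω`; backgrounds
`X` of `G_k`, `A`, `B`): `‖(G_k(Ω,X)V_kw)(x)‖ ≤ Σ_{b∈collB}[|e|s‖D^ε_Bw(b)‖κ(x,b₊) + |e|s‖w(b₊)‖Σ_i‖(D^ε_BG_k(Ω,X)e_{(x,i)})(b)‖ + (|e|s)²‖w(b₊)‖κ(x,b₊)]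
+ |a_k|(L^kε)^{−2}‖(G_k(Ω,X)avgSrc w)(x)‖`, `κ(x,y) = Σ_i‖(G_k(Ω,X)e_{(y,i)})(x)‖` — the dipole term in r14's symmetric form
`norm_propagatorK_srcDM_apply_le`; the input shape of p40 g77's `B3Op116CollarRows.collar_row_le` (`κ₁ = κ₅ = |e|s`, `κ₂ = 0`, `κ₃ = (|e|s)²`).
[cite: Balaban1982Higgs1, (3.16) p.615] [cite: Balaban1983Higgs3, (1.16) p.414, (2.10) p.426, p.433] -/
theorem norm_propagatorK_srcV_apply_collar_le {s : ℝ} (hA : ∀ b : HiggsLattice.PBond P 0, |A b| ≤ s) (w : ScalarField P 0 N)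
    (x : HiggsLattice.Site P 0) :
    ‖propagatorK C Ω X msq a k (srcV C A B k Ω a w) x‖
      ≤ (∑ b ∈ collB Ω A,
          (|C.e| * s * ‖covDeriv C B w b‖ * (∑ i : Ix N, ‖propagatorK C Ω X msq a k (cb P N 0 (b.tgt, i)) x‖)
            + |C.e| * s * ‖w b.tgt‖ * (∑ i : Ix N, ‖covDeriv C B (propagatorK C Ω X msq a k (cb P N 0 (x, i))) b‖)
            + (|C.e| * s) ^ 2 * ‖w b.tgt‖ * (∑ i : Ix N, ‖propagatorK C Ω X msq a k (cb P N 0 (b.tgt, i)) x‖)))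
        + |B1.aSeq a P.L k| * (P.mesh k)⁻¹ ^ 2 * ‖propagatorK C Ω X msq a k (avgSrc C A B k w) x‖ := by
  have hε0 : 0 ≤ (P.mesh 0)⁻¹ := inv_nonneg.mpr (P.mesh_pos 0).le
  rw [map_srcV_collar C Ω A B a k (propagatorK C Ω X msq a k) w, Pi.sub_apply, Pi.neg_apply, Pi.smul_apply, Finset.sum_apply]
  refine (norm_sub_le _ _).trans (add_le_add ?_ ?_)
  · rw [norm_neg]
    refine (norm_sum_le _ _).trans (Finset.sum_le_sum fun b _ => ?_)
    rw [Pi.add_apply, Pi.add_apply, Pi.smul_apply]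
    refine (norm_add_le _ _).trans (add_le_add ((norm_add_le _ _).trans (add_le_add ?_ ?_)) ?_)
    · simpa only [LinearMap.coe_comp, Function.comp_apply, LinearMap.coe_proj, Function.eval] using
        norm_mapE_srcMD_le C A B (LinearMap.proj x ∘ₗ propagatorK C Ω X msq a k) (hA b) w
    · rw [norm_smul, Real.norm_eq_abs, abs_of_nonneg hε0]
      exact norm_propagatorK_srcDM_apply_le C A B Ω X msq a k (hA b) w x
    · simpa only [LinearMap.coe_comp, Function.comp_apply, LinearMap.coe_proj, Function.eval] using
        norm_mapE_srcMM_le C A B (LinearMap.proj x ∘ₗ propagatorK C Ω X msq a k) (hA b) w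
  · rw [norm_smul, Real.norm_eq_abs, abs_mul, abs_of_nonneg (pow_nonneg (inv_nonneg.mpr (P.mesh_pos k).le) 2)]

/-- **DERIVATIVE ROW `(D^ε_BT₀V_k^Ω(A,B)w)(b′)` OVER THE COLLAR BONDS** for any linear `T₀` on the fields on `T_ε` (a propagator
`G_k(Ω,X)`): `norm_mapE_srcV_collar_le` with `T = D^ε_B(·)(b′) ∘ T₀`; the dipole entry `ε^{−1}Σ_i‖(D^ε_BT₀dip_be_i)(b′)‖` is the
twice-differentiated (mixed) kernel — the `K^D` of `collar_row_le` in a derivative row. [cite: Balaban1982Higgs1, (3.16) p.615] [cite: Balaban1983Higgs3, (1.16) p.414, (2.10) p.426, p.433] -/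
theorem norm_covDeriv_map_srcV_collar_le (T₀ : ScalarField P 0 N →ₗ[ℝ] ScalarField P 0 N) {s : ℝ}
    (hA : ∀ b : HiggsLattice.PBond P 0, |A b| ≤ s) (w : ScalarField P 0 N) (b' : HiggsLattice.PBond P 0) :
    ‖covDeriv C B (T₀ (srcV C A B k Ω a w)) b'‖
      ≤ (∑ b ∈ collB Ω A,
          (|C.e| * s * ‖covDeriv C B w b‖ * (∑ i : Ix N, ‖covDeriv C B (T₀ (cb P N 0 (b.tgt, i))) b'‖)
            + (P.mesh 0)⁻¹ * (|C.e| * s * ‖w b.tgt‖ * ∑ i : Ix N, ‖covDeriv C B (T₀ (dip C B b (onb N i))) b'‖)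
            + (|C.e| * s) ^ 2 * ‖w b.tgt‖ * (∑ i : Ix N, ‖covDeriv C B (T₀ (cb P N 0 (b.tgt, i))) b'‖)))
        + |B1.aSeq a P.L k| * (P.mesh k)⁻¹ ^ 2 * ‖covDeriv C B (T₀ (avgSrc C A B k w)) b'‖ := by
  simpa only [LinearMap.coe_comp, Function.comp_apply, B3Op116SourceForm.covDerivAt_apply] using
    norm_mapE_srcV_collar_le C Ω A B a k (covDerivAt C B b' ∘ₗ T₀) hA w

end CollarRows

/-! ## §4 (v1.1, append-only) THE LOCATED LEIBNIZ ROW: `V_k^Ω(A,B)w` through an `Ω`-killing functional on an `Ω`-supported state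

For the genuine Hölder row of the kernel of (1.16) (`α > 0`) the twice-differentiated kernel of the symmetric form (§3: the dipole source
`ε^{−1}srcDM_b` read through a differentiated, Hölder-differenced row of `G_k(Ω,X)`) has no dictionary entry; p35's THEOREM A′
(`B3Op116LeibnizRows.inv_smul_sum_srcDM_eq`, a TORUS identity) moves that derivative to the state.  On a region the torus rearrangement and
the restriction `Σ_{b⊂Ω}` of `srcV` differ by the sources of the bonds NOT inside `Ω`; when the functional `T` kills every field supported
off `Ω` (a row of `G_k(Ω,X)` or of its covariant derivatives/Hölder differences at points of `Ω`, §2) and the state `w` vanishes off `Ω`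
(a column of `G_k(Ω,X′)` from a point of `Ω`, §2), what survives is: the Leibniz charges of the charged bonds INSIDE `Ω`, the charge
`(ε^{−1}|e|δ_A + ε^{−1}|e|s)‖w(b₋)‖κ_T(b₋)` of every charged bond LEAVING `Ω`, and `(3ε^{−1}|e|s + 2(|e|s)²)‖w(b₊)‖κ_T(b₊)` of every bond of
`supp A` ENTERING `Ω` — the FACE CHARGES of DESIGN-B3-116-box §1c (value states with one `ε^{−1}`, to be summed over the `(d−1)`-dimensional
faces with p40's `B3Op116CollarRows.sum_face_far_pair_le`, v1.1 §5 there). -/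

section LeibnizCollar

open scoped Classical

open B3Op116Pieces (fOne fOne_apply norm_fOne_apply_le norm_U_apply)
open B3Op116LeibnizRows (pred nMul map_srcV_univ_leibniz norm_nMul_apply_le U_neg_mulM_apply)
open B3Op116RegionSources (nMul_eq_zero)

variable (C : ChargeData N) (Ω : Finset (HiggsLattice.Site P 0)) (A B : HiggsLattice.VecField P 0) (a : ℝ) (k : ℕ)

/-- the CHARGED BONDS INSIDE `Ω`: `b ⊂ Ω` with `A_b ≠ 0` or `A_{b−e_μ} ≠ 0` (the bonds whose Leibniz charge at `b₋` or whose `M^*`-sources at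
`b₊` may be nonzero). [cite: Balaban1982Higgs1, (3.16) p.615] [cite: Balaban1983Higgs3, (1.16) p.414, p.433] -/
def inB (Ω : Finset (HiggsLattice.Site P 0)) (A : HiggsLattice.VecField P 0) : Finset (HiggsLattice.PBond P 0) :=
  Finset.univ.filter fun b => Inside Ω b ∧ (A b ≠ 0 ∨ A (pred b) ≠ 0)

/-- the CHARGED BONDS LEAVING `Ω`: `b₋ ∈ Ω`, `b₊ ∉ Ω`, `A_b ≠ 0` or `A_{b−e_μ} ≠ 0`. [cite: Balaban1983Higgs3, (1.16) p.414, p.433] -/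
def exB (Ω : Finset (HiggsLattice.Site P 0)) (A : HiggsLattice.VecField P 0) : Finset (HiggsLattice.PBond P 0) :=
  Finset.univ.filter fun b => b.src ∈ Ω ∧ b.tgt ∉ Ω ∧ (A b ≠ 0 ∨ A (pred b) ≠ 0)

/-- the bonds of `supp A` ENTERING `Ω`: `b₋ ∉ Ω`, `b₊ ∈ Ω`, `A_b ≠ 0`. [cite: Balaban1983Higgs3, (1.16) p.414, p.433] -/
def enB (Ω : Finset (HiggsLattice.Site P 0)) (A : HiggsLattice.VecField P 0) : Finset (HiggsLattice.PBond P 0) :=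
  Finset.univ.filter fun b => b.src ∉ Ω ∧ b.tgt ∈ Ω ∧ A b ≠ 0

variable {Ω A}

/-- Membership in `inB`. [cite: Balaban1983Higgs3, p.433] -/
theorem mem_inB {b : HiggsLattice.PBond P 0} : b ∈ inB Ω A ↔ Inside Ω b ∧ (A b ≠ 0 ∨ A (pred b) ≠ 0) := by
  simp [inB]

/-- Membership in `exB`. [cite: Balaban1983Higgs3, p.433] -/
theorem mem_exB {b : HiggsLattice.PBond P 0} : b ∈ exB Ω A ↔ b.src ∈ Ω ∧ b.tgt ∉ Ω ∧ (A b ≠ 0 ∨ A (pred b) ≠ 0) := by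
  simp [exB]

/-- Membership in `enB`. [cite: Balaban1983Higgs3, p.433] -/
theorem mem_enB {b : HiggsLattice.PBond P 0} : b ∈ enB Ω A ↔ b.src ∉ Ω ∧ b.tgt ∈ Ω ∧ A b ≠ 0 := by
  simp [enB]

variable (Ω A)

/-- **The region operator against the torus operator**: `V_k^Ω w = V_k^{T_ε} w + Σ_{b ⊄ Ω} bondSrc_b w` (the averaging part does not see `Ω`).
[cite: Balaban1982Higgs1, (3.16) p.615] [cite: Balaban1983Higgs3, (1.16) p.414] -/
theorem srcV_eq_univ_add (w : ScalarField P 0 N) :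
    srcV C A B k Ω a w
      = srcV C A B k Finset.univ a w + ∑ b : HiggsLattice.PBond P 0, (if Inside Ω b then 0 else bondSrc C A B b w) := by
  have hIn : ∀ b : HiggsLattice.PBond P 0, Inside (Finset.univ : Finset (HiggsLattice.Site P 0)) b :=
    fun b => ⟨Finset.mem_univ _, Finset.mem_univ _⟩
  have hsum : (∑ b : HiggsLattice.PBond P 0, (if Inside Ω b then bondSrc C A B b w else 0))
      + ∑ b : HiggsLattice.PBond P 0, (if Inside Ω b then 0 else bondSrc C A B b w)
      = ∑ b : HiggsLattice.PBond P 0, (if Inside (Finset.univ : Finset (HiggsLattice.Site P 0)) b then bondSrc C A B b w else 0) := by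
    rw [← Finset.sum_add_distrib]
    refine Finset.sum_congr rfl fun b _ => ?_
    rw [if_pos (hIn b)]
    split_ifs <;> simp
  unfold srcV
  rw [← hsum]
  abel

variable {M' : Type*} [NormedAddCommGroup M'] [NormedSpace ℝ M']

/-- `‖D^ε_Bw(b)‖ = ε^{−1}‖w(b₋)‖` when `w(b₊) = 0` (a bond leaving the support of `w`). [cite: Balaban1982Higgs1, (1.7) p.605] -/
theorem norm_covDeriv_of_tgt_eq_zero (w : ScalarField P 0 N) {b : HiggsLattice.PBond P 0} (h : w b.tgt = 0) :
    ‖covDeriv C B w b‖ = (P.mesh 0)⁻¹ * ‖w b.src‖ := by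
  unfold covDeriv
  rw [h, map_zero, zero_sub, norm_smul, norm_neg, Real.norm_eq_abs, abs_of_pos (inv_pos.mpr (P.mesh_pos 0))]

/-- `‖D^ε_Bw(b)‖ = ε^{−1}‖w(b₊)‖` when `w(b₋) = 0` (a bond entering the support of `w`; `|U| = 1`). [cite: Balaban1982Higgs1, (1.7) p.605] -/
theorem norm_covDeriv_of_src_eq_zero (w : ScalarField P 0 N) {b : HiggsLattice.PBond P 0} (h : w b.src = 0) :
    ‖covDeriv C B w b‖ = (P.mesh 0)⁻¹ * ‖w b.tgt‖ := by
  unfold covDeriv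
  rw [h, sub_zero, norm_smul, norm_U_apply, Real.norm_eq_abs, abs_of_pos (inv_pos.mpr (P.mesh_pos 0))]

/-- The per-bond bound behind `norm_mapE_srcV_collar_leibniz_le`: the torus Leibniz terms of the bond `b` plus its correction source
`T(bondSrc_b w)·[b ⊄ Ω]`, located (inside / leaving / entering / outside; charged / uncharged). [cite: Balaban1982Higgs1, (3.16) p.615] [cite: Balaban1983Higgs3, (1.16) p.414, p.433] -/
theorem leibniz_bond_collar_le (T : ScalarField P 0 N →ₗ[ℝ] M') {s δA : ℝ} (hs : 0 ≤ s) (hδA : 0 ≤ δA)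
    (hA : ∀ b : HiggsLattice.PBond P 0, |A b| ≤ s)
    (hregA : ∀ (z : HiggsLattice.Site P 0) (μ ν : Fin P.d), |A ⟨z.shift ν, μ⟩ - A ⟨z, μ⟩| ≤ δA)
    (hT : ∀ y : HiggsLattice.Site P 0, y ∉ Ω → ∀ v : E N, T (Pi.single y v) = 0)
    (w : ScalarField P 0 N) (hw : ∀ y : HiggsLattice.Site P 0, y ∉ Ω → w y = 0) (b : HiggsLattice.PBond P 0) :
    ‖T (srcMD C A B b w) + T (Pi.single b.src (nMul C A b (w b.src) - fOne C (P.mesh 0) (A b) (covDeriv C B w b)))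
        + T (srcMM C A B b w)‖
      + ‖T (if Inside Ω b then 0 else bondSrc C A B b w)‖
      ≤ (if b ∈ inB Ω A then
            |C.e| * s * ‖covDeriv C B w b‖ * (∑ i : Ix N, ‖T (cb P N 0 (b.tgt, i))‖)
              + ((P.mesh 0)⁻¹ * (|C.e| * δA) * ‖w b.src‖ + |C.e| * s * ‖covDeriv C B w b‖) * (∑ i : Ix N, ‖T (cb P N 0 (b.src, i))‖)
              + (|C.e| * s) ^ 2 * ‖w b.tgt‖ * (∑ i : Ix N, ‖T (cb P N 0 (b.tgt, i))‖)
          else 0)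
        + (if b ∈ exB Ω A then
            ((P.mesh 0)⁻¹ * (|C.e| * δA) + (P.mesh 0)⁻¹ * (|C.e| * s)) * ‖w b.src‖ * (∑ i : Ix N, ‖T (cb P N 0 (b.src, i))‖)
          else 0)
        + (if b ∈ enB Ω A then
            (3 * ((P.mesh 0)⁻¹ * (|C.e| * s)) + 2 * (|C.e| * s) ^ 2) * ‖w b.tgt‖ * (∑ i : Ix N, ‖T (cb P N 0 (b.tgt, i))‖)
          else 0) := by
  have hε : 0 < (P.mesh 0)⁻¹ := inv_pos.mpr (P.mesh_pos 0)
  have hes : 0 ≤ |C.e| * s := mul_nonneg (abs_nonneg _) hs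
  have hκs : 0 ≤ ∑ i : Ix N, ‖T (cb P N 0 (b.src, i))‖ := Finset.sum_nonneg fun _ _ => norm_nonneg _
  have hκt : 0 ≤ ∑ i : Ix N, ‖T (cb P N 0 (b.tgt, i))‖ := Finset.sum_nonneg fun _ _ => norm_nonneg _
  -- the right side is nonnegative (used in all the vanishing cases)
  have hR : 0 ≤ (if b ∈ inB Ω A then
            |C.e| * s * ‖covDeriv C B w b‖ * (∑ i : Ix N, ‖T (cb P N 0 (b.tgt, i))‖)
              + ((P.mesh 0)⁻¹ * (|C.e| * δA) * ‖w b.src‖ + |C.e| * s * ‖covDeriv C B w b‖) * (∑ i : Ix N, ‖T (cb P N 0 (b.src, i))‖)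
              + (|C.e| * s) ^ 2 * ‖w b.tgt‖ * (∑ i : Ix N, ‖T (cb P N 0 (b.tgt, i))‖)
          else 0)
        + (if b ∈ exB Ω A then
            ((P.mesh 0)⁻¹ * (|C.e| * δA) + (P.mesh 0)⁻¹ * (|C.e| * s)) * ‖w b.src‖ * (∑ i : Ix N, ‖T (cb P N 0 (b.src, i))‖)
          else 0)
        + (if b ∈ enB Ω A then
            (3 * ((P.mesh 0)⁻¹ * (|C.e| * s)) + 2 * (|C.e| * s) ^ 2) * ‖w b.tgt‖ * (∑ i : Ix N, ‖T (cb P N 0 (b.tgt, i))‖)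
          else 0) := by
    have h1 : 0 ≤ ‖covDeriv C B w b‖ := norm_nonneg _
    have h2 : 0 ≤ ‖w b.src‖ := norm_nonneg _
    have h3 : 0 ≤ ‖w b.tgt‖ := norm_nonneg _
    have h4 : 0 ≤ |C.e| := abs_nonneg _
    refine add_nonneg (add_nonneg ?_ ?_) ?_ <;> split_ifs <;> positivity
  -- the generic bounds of the three torus terms (p35's FILE 4α §2, per bond)
  have gMD : ‖T (srcMD C A B b w)‖ ≤ |C.e| * s * ‖covDeriv C B w b‖ * ∑ i : Ix N, ‖T (cb P N 0 (b.tgt, i))‖ :=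
    norm_mapE_srcMD_le C A B T (hA b) w
  have gMM : ‖T (srcMM C A B b w)‖ ≤ (|C.e| * s) ^ 2 * ‖w b.tgt‖ * ∑ i : Ix N, ‖T (cb P N 0 (b.tgt, i))‖ :=
    norm_mapE_srcMM_le C A B T (hA b) w
  have gL : ‖T (Pi.single b.src (nMul C A b (w b.src) - fOne C (P.mesh 0) (A b) (covDeriv C B w b)))‖
      ≤ ((P.mesh 0)⁻¹ * (|C.e| * δA) * ‖w b.src‖ + |C.e| * s * ‖covDeriv C B w b‖) * ∑ i : Ix N, ‖T (cb P N 0 (b.src, i))‖ := by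
    refine (norm_mapE_single_le T b.src _).trans (mul_le_mul_of_nonneg_right ?_ hκs)
    refine (norm_sub_le _ _).trans (add_le_add (norm_nMul_apply_le C A hregA b _) ?_)
    exact (norm_fOne_apply_le C (P.mesh_pos 0).ne' (A b) _).trans
      (mul_le_mul_of_nonneg_right (mul_le_mul_of_nonneg_left (hA b) (abs_nonneg _)) (norm_nonneg _))
  -- the killed single-site sources
  have kMD : b.tgt ∉ Ω → T (srcMD C A B b w) = 0 := fun h => by rw [srcMD, hT _ h]
  have kMM : b.tgt ∉ Ω → T (srcMM C A B b w) = 0 := fun h => by rw [srcMM, hT _ h]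
  have kL : b.src ∉ Ω → T (Pi.single b.src (nMul C A b (w b.src) - fOne C (P.mesh 0) (A b) (covDeriv C B w b))) = 0 :=
    fun h => hT _ h _
  -- the uncharged bond: all three torus terms vanish, and so does the correction
  have hf0 : fOne C (P.mesh 0) 0 = 0 := by ext v; simp [fOne_apply, ChargeData.U_zero]
  have zL : A b = 0 → A (pred b) = 0 →
      T (Pi.single b.src (nMul C A b (w b.src) - fOne C (P.mesh 0) (A b) (covDeriv C B w b))) = 0 := fun h0 hp => by
    rw [nMul_eq_zero C A hp h0, h0, hf0, _root_.zero_apply, _root_.zero_apply, sub_self, Pi.single_zero, map_zero]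
  have zC : A b = 0 → T (if Inside Ω b then 0 else bondSrc C A B b w) = 0 := fun h0 => by
    rw [bondSrc_eq_zero C A B h0, ite_self, map_zero]
  by_cases h1 : b.src ∈ Ω <;> by_cases h2 : b.tgt ∈ Ω
  · -- INSIDE
    have hI : Inside Ω b := ⟨h1, h2⟩
    rw [if_pos hI, map_zero, norm_zero, add_zero]
    by_cases hch : A b ≠ 0 ∨ A (pred b) ≠ 0
    · have hin : b ∈ inB Ω A := mem_inB.2 ⟨hI, hch⟩
      have hex : b ∉ exB Ω A := fun h => (mem_exB.1 h).2.1 h2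
      have hen : b ∉ enB Ω A := fun h => (mem_enB.1 h).1 h1
      rw [if_pos hin, if_neg hex, if_neg hen, add_zero, add_zero]
      exact (norm_add_le _ _).trans (add_le_add ((norm_add_le _ _).trans (add_le_add gMD gL)) gMM)
    · push Not at hch
      rw [srcMD_eq_zero C A B hch.1, srcMM_eq_zero C A B hch.1, zL hch.1 hch.2, map_zero, zero_add, add_zero, norm_zero]
      exact hR
  · -- LEAVING: `b₋ ∈ Ω`, `b₊ ∉ Ω`; `w(b₊) = 0`
    have hI : ¬ Inside Ω b := fun h => h2 h.2
    have hwt : w b.tgt = 0 := hw _ h2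
    -- the correction source vanishes: `srcMD`, `srcMM` sit at `b₊ ∉ Ω`, `srcDM_b w = dip_b(M_b w(b₊)) = dip_b(M_b 0) = 0`
    have hC : T (if Inside Ω b then 0 else bondSrc C A B b w) = 0 := by
      rw [if_neg hI, bondSrc, map_add, map_add, map_smul, kMD h2, kMM h2, srcDM, hwt, map_zero, zero_add, add_zero]
      rw [dip, map_zero, Pi.single_zero, Pi.single_zero, sub_self, map_zero, smul_zero]
    rw [hC, norm_zero, add_zero, kMD h2, kMM h2, zero_add, add_zero]
    by_cases hch : A b ≠ 0 ∨ A (pred b) ≠ 0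
    · have hex : b ∈ exB Ω A := mem_exB.2 ⟨h1, h2, hch⟩
      have hin : b ∉ inB Ω A := fun h => hI (mem_inB.1 h).1
      have hen : b ∉ enB Ω A := fun h => (mem_enB.1 h).1 h1
      rw [if_neg hin, if_pos hex, if_neg hen, zero_add, add_zero]
      refine gL.trans (le_of_eq ?_)
      rw [norm_covDeriv_of_tgt_eq_zero C B w hwt]
      ring
    · push Not at hch
      rw [zL hch.1 hch.2, norm_zero]
      exact hR
  · -- ENTERING: `b₋ ∉ Ω`, `b₊ ∈ Ω`; `w(b₋) = 0`; the Leibniz charge at `b₋` is killed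
    have hI : ¬ Inside Ω b := fun h => h1 h.1
    have hws : w b.src = 0 := hw _ h1
    rw [kL h1, add_zero]
    by_cases h0 : A b = 0
    · rw [srcMD_eq_zero C A B h0, srcMM_eq_zero C A B h0, zC h0, map_zero, add_zero, norm_zero, add_zero]
      exact hR
    · have hen : b ∈ enB Ω A := mem_enB.2 ⟨h1, h2, h0⟩
      have hin : b ∉ inB Ω A := fun h => hI (mem_inB.1 h).1
      have hex : b ∉ exB Ω A := fun h => (mem_exB.1 h).2.1 h2
      rw [if_neg hin, if_neg hex, if_pos hen, zero_add, zero_add]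
      have hD : ‖covDeriv C B w b‖ = (P.mesh 0)⁻¹ * ‖w b.tgt‖ := norm_covDeriv_of_src_eq_zero C B w hws
      -- the correction source of the entering bond: `srcMD + ε⁻¹srcDM + srcMM` with `T(δ_{b₋}·) = 0`, `U(−εB_b)M_bv = F₁(A_b)v`
      have hDM : ‖T (srcDM C A B b w)‖ ≤ |C.e| * s * ‖w b.tgt‖ * ∑ i : Ix N, ‖T (cb P N 0 (b.tgt, i))‖ := by
        rw [srcDM, dip, map_sub, hT _ h1, sub_zero, U_neg_mulM_apply]
        refine (norm_mapE_single_le T b.tgt _).trans (mul_le_mul_of_nonneg_right ?_ hκt)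
        exact (norm_fOne_apply_le C (P.mesh_pos 0).ne' (A b) _).trans
          (mul_le_mul_of_nonneg_right (mul_le_mul_of_nonneg_left (hA b) (abs_nonneg _)) (norm_nonneg _))
      have hDM' : ‖(P.mesh 0)⁻¹ • T (srcDM C A B b w)‖
          ≤ (P.mesh 0)⁻¹ * (|C.e| * s * ‖w b.tgt‖ * ∑ i : Ix N, ‖T (cb P N 0 (b.tgt, i))‖) := by
        rw [norm_smul, Real.norm_eq_abs, abs_of_pos hε]
        exact mul_le_mul_of_nonneg_left hDM hε.le
      have hC : ‖T (if Inside Ω b then 0 else bondSrc C A B b w)‖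
          ≤ (2 * ((P.mesh 0)⁻¹ * (|C.e| * s)) + (|C.e| * s) ^ 2) * ‖w b.tgt‖ * ∑ i : Ix N, ‖T (cb P N 0 (b.tgt, i))‖ := by
        rw [if_neg hI, bondSrc, map_add, map_add, map_smul]
        refine (norm_add_le _ _).trans ((add_le_add ((norm_add_le _ _).trans (add_le_add gMD hDM')) gMM).trans (le_of_eq ?_))
        rw [hD]; ring
      have hX : ‖T (srcMD C A B b w) + T (srcMM C A B b w)‖
          ≤ ((P.mesh 0)⁻¹ * (|C.e| * s) + (|C.e| * s) ^ 2) * ‖w b.tgt‖ * ∑ i : Ix N, ‖T (cb P N 0 (b.tgt, i))‖ := by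
        refine (norm_add_le _ _).trans ((add_le_add gMD gMM).trans (le_of_eq ?_))
        rw [hD]; ring
      refine (add_le_add hX hC).trans (le_of_eq ?_)
      ring
  · -- OUTSIDE: everything is killed
    have hI : ¬ Inside Ω b := fun h => h1 h.1
    have hC : T (if Inside Ω b then 0 else bondSrc C A B b w) = 0 := by
      rw [if_neg hI, bondSrc, map_add, map_add, map_smul, kMD h2, kMM h2, srcDM, dip, map_sub, hT _ h1, hT _ h2, sub_zero,
        smul_zero, add_zero, add_zero]
    rw [hC, kMD h2, kMM h2, kL h1, add_zero, add_zero, norm_zero, add_zero]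
    exact hR

/-- **THE LOCATED LEIBNIZ ROW OF `V_k^Ω(A,B)w`** (every region `Ω`; `sup_b|A_b| ≤ s`, `A` regular with `δ_A`; `T` a linear functional
KILLING every single-site field off `Ω`; `w` a field VANISHING off `Ω`):
`‖T(V_k^Ω w)‖ ≤ Σ_{b∈inB}[|e|s‖D^ε_Bw(b)‖κ_T(b₊) + (ε^{−1}|e|δ_A‖w(b₋)‖ + |e|s‖D^ε_Bw(b)‖)κ_T(b₋) + (|e|s)²‖w(b₊)‖κ_T(b₊)]`
`+ Σ_{b∈exB}(ε^{−1}|e|δ_A + ε^{−1}|e|s)‖w(b₋)‖κ_T(b₋) + Σ_{b∈enB}(3ε^{−1}|e|s + 2(|e|s)²)‖w(b₊)‖κ_T(b₊) + |a_k|(L^kε)^{−2}‖T(avgSrc w)‖`,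
`κ_T(y) = Σ_i‖Te_{(y,i)}‖` — p35's torus Leibniz row (`B3Op116LeibnizRows.norm_mapE_srcV_le_leibniz`) on a region WITHOUT the deep-support
hypothesis of R1 (`B3Op116RegionSources.norm_mapE_srcV_region_le`): the bonds of `supp A` crossing `∂Ω` leave FACE CHARGES, value states
with one `ε^{−1}`, at their endpoint in `Ω`. [cite: Balaban1982Higgs1, (3.16) p.615] [cite: Balaban1983Higgs3, (1.16) p.414, (2.5) p.424, p.433] -/
theorem norm_mapE_srcV_collar_leibniz_le (T : ScalarField P 0 N →ₗ[ℝ] M') {s δA : ℝ} (hs : 0 ≤ s) (hδA : 0 ≤ δA)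
    (hA : ∀ b : HiggsLattice.PBond P 0, |A b| ≤ s)
    (hregA : ∀ (z : HiggsLattice.Site P 0) (μ ν : Fin P.d), |A ⟨z.shift ν, μ⟩ - A ⟨z, μ⟩| ≤ δA)
    (hT : ∀ y : HiggsLattice.Site P 0, y ∉ Ω → ∀ v : E N, T (Pi.single y v) = 0)
    (w : ScalarField P 0 N) (hw : ∀ y : HiggsLattice.Site P 0, y ∉ Ω → w y = 0) :
    ‖T (srcV C A B k Ω a w)‖
      ≤ (∑ b ∈ inB Ω A,
          (|C.e| * s * ‖covDeriv C B w b‖ * (∑ i : Ix N, ‖T (cb P N 0 (b.tgt, i))‖)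
            + ((P.mesh 0)⁻¹ * (|C.e| * δA) * ‖w b.src‖ + |C.e| * s * ‖covDeriv C B w b‖) * (∑ i : Ix N, ‖T (cb P N 0 (b.src, i))‖)
            + (|C.e| * s) ^ 2 * ‖w b.tgt‖ * (∑ i : Ix N, ‖T (cb P N 0 (b.tgt, i))‖)))
        + (∑ b ∈ exB Ω A,
            ((P.mesh 0)⁻¹ * (|C.e| * δA) + (P.mesh 0)⁻¹ * (|C.e| * s)) * ‖w b.src‖ * (∑ i : Ix N, ‖T (cb P N 0 (b.src, i))‖))
        + (∑ b ∈ enB Ω A,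
            (3 * ((P.mesh 0)⁻¹ * (|C.e| * s)) + 2 * (|C.e| * s) ^ 2) * ‖w b.tgt‖ * (∑ i : Ix N, ‖T (cb P N 0 (b.tgt, i))‖))
        + |B1.aSeq a P.L k| * (P.mesh k)⁻¹ ^ 2 * ‖T (avgSrc C A B k w)‖ := by
  rw [srcV_eq_univ_add, map_add, map_srcV_univ_leibniz, map_sum]
  have hper := leibniz_bond_collar_le C B (Ω := Ω) (A := A) T hs hδA hA hregA hT w hw
  -- `‖(−Σ_b X_b − c•T avg) + Σ_b Y_b‖ ≤ Σ_b (‖X_b‖ + ‖Y_b‖) + |c|‖T avg‖`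
  have hsplit : ‖-(∑ b : HiggsLattice.PBond P 0,
          (T (srcMD C A B b w) + T (Pi.single b.src (nMul C A b (w b.src) - fOne C (P.mesh 0) (A b) (covDeriv C B w b)))
            + T (srcMM C A B b w)))
        - (B1.aSeq a P.L k * (P.mesh k)⁻¹ ^ 2) • T (avgSrc C A B k w)
        + ∑ b : HiggsLattice.PBond P 0, T (if Inside Ω b then 0 else bondSrc C A B b w)‖
      ≤ (∑ b : HiggsLattice.PBond P 0,
          (‖T (srcMD C A B b w) + T (Pi.single b.src (nMul C A b (w b.src) - fOne C (P.mesh 0) (A b) (covDeriv C B w b)))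
              + T (srcMM C A B b w)‖
            + ‖T (if Inside Ω b then 0 else bondSrc C A B b w)‖))
        + |B1.aSeq a P.L k| * (P.mesh k)⁻¹ ^ 2 * ‖T (avgSrc C A B k w)‖ := by
    refine (norm_add_le _ _).trans ?_
    have ha : ‖-(∑ b : HiggsLattice.PBond P 0,
          (T (srcMD C A B b w) + T (Pi.single b.src (nMul C A b (w b.src) - fOne C (P.mesh 0) (A b) (covDeriv C B w b)))
            + T (srcMM C A B b w)))
        - (B1.aSeq a P.L k * (P.mesh k)⁻¹ ^ 2) • T (avgSrc C A B k w)‖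
        ≤ (∑ b : HiggsLattice.PBond P 0,
            ‖T (srcMD C A B b w) + T (Pi.single b.src (nMul C A b (w b.src) - fOne C (P.mesh 0) (A b) (covDeriv C B w b)))
              + T (srcMM C A B b w)‖)
          + |B1.aSeq a P.L k| * (P.mesh k)⁻¹ ^ 2 * ‖T (avgSrc C A B k w)‖ := by
      refine (norm_sub_le _ _).trans (add_le_add ?_ ?_)
      · rw [norm_neg]; exact norm_sum_le _ _
      · rw [norm_smul, Real.norm_eq_abs, abs_mul, abs_of_nonneg (pow_nonneg (inv_nonneg.mpr (P.mesh_pos k).le) 2)]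
    have hb : ‖∑ b : HiggsLattice.PBond P 0, T (if Inside Ω b then 0 else bondSrc C A B b w)‖
        ≤ ∑ b : HiggsLattice.PBond P 0, ‖T (if Inside Ω b then 0 else bondSrc C A B b w)‖ := norm_sum_le _ _
    have hx : (∑ b : HiggsLattice.PBond P 0,
          (‖T (srcMD C A B b w) + T (Pi.single b.src (nMul C A b (w b.src) - fOne C (P.mesh 0) (A b) (covDeriv C B w b)))
              + T (srcMM C A B b w)‖
            + ‖T (if Inside Ω b then 0 else bondSrc C A B b w)‖))
        = (∑ b : HiggsLattice.PBond P 0,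
            ‖T (srcMD C A B b w) + T (Pi.single b.src (nMul C A b (w b.src) - fOne C (P.mesh 0) (A b) (covDeriv C B w b)))
              + T (srcMM C A B b w)‖)
          + ∑ b : HiggsLattice.PBond P 0, ‖T (if Inside Ω b then 0 else bondSrc C A B b w)‖ := Finset.sum_add_distrib
    rw [hx]
    refine (add_le_add ha hb).trans (le_of_eq ?_)
    ring
  refine hsplit.trans ?_
  simp only [add_le_add_iff_right]
  refine (Finset.sum_le_sum fun b _ => hper b).trans (le_of_eq ?_)
  rw [Finset.sum_add_distrib, Finset.sum_add_distrib, Finset.sum_ite_mem, Finset.sum_ite_mem, Finset.sum_ite_mem, Finset.univ_inter,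
    Finset.univ_inter, Finset.univ_inter]

end LeibnizCollar

end Literature.MathematicalPhysics.QuantumFieldTheory.Balaban1983to89.B3Op116CollarSources

end
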